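import Mathlib
import Summits.ValiantsHypothesis.ValiantsHypothesis.Theorems.NewtonUnitEquationsTwoProductsPlanarCellRelationBlocks
import HarnessLib

/-!
# Crux `TwoProducts` (stmt-ValiantsHypothesis-5906): per-cell laws made GLOBAL
# (a generic cell-refinement lemma; the relation-blocks law and the single-relation law for ALL visible points)

Helper mode (`--supports stmt-ValiantsHypothesis-5906 --as helper`; val-lit-p3 g14, KEEP lineage).

* `card_le_of_perCell` — the sweep step of `logSumEngine_of_planarCellBound` (p596451) as a reusable lemma: if every weight-order
  cell family of `(u, v)` has at most `N` points, then every finite set of log-visible points (each with its own valid witness)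
  has at most `18·((#T)² + 1)·N` points, `T = tailSupport u v` (`planarOrder_classes`: the witnesses fall into `≤ 18((#T)²+1)`
  order classes, each a cell family).  `card_visible_le_of_perCell`: the same for visible points of `W = ∏(1+u_j) − ∏(1+v_j)`
  (`stub_logLinearisation`).
* `visible_global_of_relationBlocks`: `r` relation blocks (per-position hypothesis of `planarCell_relationBlocks`) ⇒ every finite
  set of visible points of `W` has `≤ 18((#T)²+1) · 2(m+1)(3(2+m+C(m,2))²)^r` points; `visible_global_of_singleRelation`: one
  relation class ⇒ `≤ 18((#T)²+1) · 12(m+1)⁵`.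
The cell count is where the sparsity enters (`#T ≤ Σ_j #A_j`); the per-cell factors are `t`-free.
Honest framing: helper corollaries outside any cone of the OPEN crux line; the residual, `PlanarCellBound`, the crux `TwoProducts`
and `VP ≠ VNP` are OPEN and NOT claimed; no summit statement is proved here.  No instances, no notation, no named facts. [folklore]
-/

noncomputable section

-- Sub = Summit single-conjunct layout: the duplicated namespace component is mandated by the tree.
set_option linter.dupNamespace false

open scoped BigOperators
open MvPolynomial
open Summit.ValiantsHypothesis.ValiantsHypothesis.Theorems.NewtonUnitEquations.TwoProducts.FormalLogLinearisation

namespace Summit.ValiantsHypothesis.ValiantsHypothesis.Theorems.NewtonUnitEquations.TwoProducts.PlanarCell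

variable {m : ℕ}

/-! ## Cell refinement -/

/-- **PER-CELL ⇒ GLOBAL.**  If every weight-order cell family of `(u, v)` has at most `N` points, then any finite set of
log-visible points (each with its own valid witness weight) has at most `18·((#T)²+1)·N` points, `T = tailSupport u v`.
[folklore] -/
theorem card_le_of_perCell (u v : Fin m → MvPolynomial (Fin 2) ℂ) (N : ℕ)
    (hcell : ∀ (R : Expo → Expo → Prop) (S' : Finset Expo), IsCellFamily u v R S' → S'.card ≤ N)
    (S : Finset Expo) (hS : ∀ l ∈ S, ∃ ξ : Fin 2 → ℝ, ValidWeight u v ξ ∧ IsStrictTop ξ (logSupport u v) l) :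
    S.card ≤ 18 * ((tailSupport u v).card ^ 2 + 1) * N := by
  classical
  set E : Finset Expo := tailSupport u v with hE
  obtain ⟨key, hkey_mem, hkey⟩ := planarOrder_classes E
  choose! ξ hξvalid hξtop using hS
  -- each key class is a cell family
  have hfib : ∀ k ∈ S.image (fun l => key (ξ l)), (S.filter fun l => key (ξ l) = k).card ≤ N := by
    intro k hk
    obtain ⟨l₀, hl₀, rfl⟩ := Finset.mem_image.1 hk
    refine hcell (fun e e' => wt (ξ l₀) e ≤ wt (ξ l₀) e') _ fun l hl => ?_
    obtain ⟨hlS, hlk⟩ := Finset.mem_filter.1 hl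
    exact ⟨ξ l, hξvalid l hlS, hξtop l hlS, fun e he e' he' => hkey _ _ hlk.symm e he e' he'⟩
  have himg : (S.image fun l => key (ξ l)).card ≤ 9 * (2 * (E.card * E.card + 1)) := by
    calc (S.image fun l => key (ξ l)).card
        ≤ (((Finset.univ : Finset (Fin 3 × Fin 3)) ×ˢ
            ((Finset.range (E.card * E.card + 1)) ×ˢ (Finset.univ : Finset Bool)))).card :=
          Finset.card_le_card fun k hk => by
            obtain ⟨l, _, rfl⟩ := Finset.mem_image.1 hk
            exact hkey_mem _
      _ = 9 * (2 * (E.card * E.card + 1)) := by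
          simp [Finset.card_product, Finset.card_univ, mul_comm]
  calc S.card ≤ N * (S.image fun l => key (ξ l)).card := Finset.card_le_mul_card_image S _ hfib
    _ ≤ N * (9 * (2 * (E.card * E.card + 1))) := Nat.mul_le_mul_left _ himg
    _ = 18 * (E.card ^ 2 + 1) * N := by ring

/-- **PER-CELL ⇒ GLOBAL, for visible points of `W`.**  Same, for strict tops of `supp(∏(1+u_j) − ∏(1+v_j))` under valid weights
(the `visible` points), when the tails have no constant term. [folklore] -/
theorem card_visible_le_of_perCell (u v : Fin m → MvPolynomial (Fin 2) ℂ) (hu0 : ∀ j, coeff 0 (u j) = 0)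
    (hv0 : ∀ j, coeff 0 (v j) = 0) (N : ℕ)
    (hcell : ∀ (R : Expo → Expo → Prop) (S' : Finset Expo), IsCellFamily u v R S' → S'.card ≤ N)
    (S : Finset Expo) (hS : ∀ l ∈ S, ∃ ξ : Fin 2 → ℝ, ValidWeight u v ξ ∧ IsStrictTop ξ ↑(tailDiff u v).support l) :
    S.card ≤ 18 * ((tailSupport u v).card ^ 2 + 1) * N := by
  refine card_le_of_perCell u v N hcell S fun l hl => ?_
  obtain ⟨ξ, hval, htop⟩ := hS l hl
  exact ⟨ξ, hval, (stub_logLinearisation m u v hu0 hv0 ξ hval l).1 htop⟩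

/-! ## Global forms of the relation laws -/

/-- **RELATION BLOCKS ⇒ GLOBAL COUNT.**  Under the per-position block hypothesis of `planarCell_relationBlocks`, every finite set
of visible points of `W` has at most `18((#T)²+1) · 2(m+1)(3(2+m+C(m,2))²)^r` points. [folklore] -/
theorem visible_global_of_relationBlocks (u v : Fin m → MvPolynomial (Fin 2) ℂ) (A : Fin m → Finset Expo)
    (hA0 : ∀ j, (0 : Expo) ∉ A j) (huA : ∀ j, (u j).support ⊆ A j) (hvA : ∀ j, (v j).support ⊆ A j)
    {r : ℕ} (Jc : Fin r → Finset (Fin m)) (ac bc : Fin r → Fin m → Expo)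
    (hSR : ∀ a ∈ tuples A, ∀ b ∈ tuples A, a ≠ b → ∑ j, a j = ∑ j, b j → ∀ i, a i ≠ b i →
      ∃ k : Fin r, i ∈ Jc k ∧
        ((∀ j ∈ Jc k, a j = ac k j ∧ b j = bc k j) ∨ (∀ j ∈ Jc k, a j = bc k j ∧ b j = ac k j)))
    (S : Finset Expo) (hS : ∀ l ∈ S, ∃ ξ : Fin 2 → ℝ, ValidWeight u v ξ ∧ IsStrictTop ξ ↑(tailDiff u v).support l) :
    S.card ≤ 18 * ((tailSupport u v).card ^ 2 + 1) * (2 * (m + 1) * (3 * (2 + m + m.choose 2) ^ 2) ^ r) := by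
  have hu0 : ∀ j, coeff 0 (u j) = 0 := fun j => notMem_support_iff.1 fun h => hA0 j (huA j h)
  have hv0 : ∀ j, coeff 0 (v j) = 0 := fun j => notMem_support_iff.1 fun h => hA0 j (hvA j h)
  exact card_visible_le_of_perCell u v hu0 hv0 _
    (fun R S' hS' => planarCell_relationBlocks u v A hA0 huA hvA Jc ac bc hSR R S' hS') S hS

/-- **SINGLE RELATION ⇒ GLOBAL COUNT.**  One primitive relation class ⇒ every finite set of visible points of `W` has at most
`18((#T)²+1) · 12(m+1)⁵` points. [folklore] -/
theorem visible_global_of_singleRelation (u v : Fin m → MvPolynomial (Fin 2) ℂ) (A : Fin m → Finset Expo)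
    (hA0 : ∀ j, (0 : Expo) ∉ A j) (huA : ∀ j, (u j).support ⊆ A j) (hvA : ∀ j, (v j).support ⊆ A j)
    (hrel : ∃ J : Finset (Fin m), ∃ a₀ b₀ : Fin m → Expo, ∀ a ∈ tuples A, ∀ b ∈ tuples A, a ≠ b → ∑ j, a j = ∑ j, b j →
      (∀ j, a j ≠ b j ↔ j ∈ J) ∧ ((∀ j ∈ J, a j = a₀ j ∧ b j = b₀ j) ∨ (∀ j ∈ J, a j = b₀ j ∧ b j = a₀ j)))
    (S : Finset Expo) (hS : ∀ l ∈ S, ∃ ξ : Fin 2 → ℝ, ValidWeight u v ξ ∧ IsStrictTop ξ ↑(tailDiff u v).support l) :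
    S.card ≤ 18 * ((tailSupport u v).card ^ 2 + 1) * (12 * (m + 1) ^ 5) := by
  have hu0 : ∀ j, coeff 0 (u j) = 0 := fun j => notMem_support_iff.1 fun h => hA0 j (huA j h)
  have hv0 : ∀ j, coeff 0 (v j) = 0 := fun j => notMem_support_iff.1 fun h => hA0 j (hvA j h)
  exact card_visible_le_of_perCell u v hu0 hv0 _
    (fun R S' hS' => singleRelationLaw_tfree u v A hA0 huA hvA hrel R S' hS') S hS

end Summit.ValiantsHypothesis.ValiantsHypothesis.Theorems.NewtonUnitEquations.TwoProducts.PlanarCell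

end
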